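import Literature.Probability.RandomPlanarGeometry.SLEEightThirdsRestrictionLaw
import Literature.Probability.RandomPlanarGeometry.OneSidedExcursionCloudInterior
import Literature.Probability.RandomPlanarGeometry.HullDecomposition
import Literature.Probability.RandomPlanarGeometry.HullApproximation
import HarnessLib

/-!
# The filling of a path from `0` to `∞` in `ℍ` is a configuration of `Ω`; [LSW] Prop. 4.1 ⇒ `P_1` exists ⇒ p. 5 result 2

Proof-only file (no named fact; one auxiliary notion, the filling, with a real definition),
after

* G. F. Lawler, O. Schramm, W. Werner, *Conformal restriction: the chordal case*, J. Amer.
  Math. Soc. **16** (2003) 917–955, arXiv:math/0209343 (**[LSW]**, arXiv page numbers), §4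
  "Brownian excursions", Prop. 4.1 (p. 16, "due to Bálint Virág"): "For all `A ∈ 𝒬*`,
  `P[B[0, ∞) ∩ A = ∅] = Φ'_A(0)`", for the Brownian excursion `B` from `0` to `∞` in `ℍ`
  ("`B_t = X_t + i Y_t`", `X` a standard Brownian motion, `Y` an independent three-dimensional
  Bessel process; "`B` is a strong Markov process and `B(0, ∞) ⊂ ℍ` almost surely", "almost
  surely `lim_{t → ∞} Y_t = ∞`"), with the sentences framing it: "The next proposition […]
  implies that the law of the filling `F^ℝ_ℍ(B)` of the path of a Brownian excursion `B` from
  `0` in `ℍ` is `P_1`" and "We have just proved that the two-sided restriction measure `P_1`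
  exists."; Def. 3.1 (p. 10, the space `Ω`); §2 p. 8 ("Fillings").

STATE OF THE TREE (2026-08-15). p. 5 result 2 of [LSW] — the named fact
`Literature.Probability.RandomPlanarGeometry.LawlerSchrammWerner2003` (`ConformalRestriction`:
chordal restriction + simple curves ⇒ SLE_{8/3}) — is reduced to ONE input, the existence of a
two-sided restriction measure of exponent `1`
(`LawlerSchrammWerner2003_of_exists_one`, file `OneSidedExcursionCloudInterior`: `P⁺_β` for all
`β > 0` as left-filled Poissonian clouds of hung `P_1`-samples, Lawler (2005) Prop. 9.13, the
positivity `P⁺_β{i ∈ int K} > 0`, Cor. 8.6, Prop. 3.3, Lemma 3.2, Thm. 6.1 — all proved). In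
[LSW] the measure `P_1` is the law of the filled Brownian excursion (§4, Prop. 4.1). This file
proves the DETERMINISTIC half of that sentence and isolates the probabilistic half as a
hypothesis about a random path:

* `Literature.Probability.RandomPlanarGeometry.chordalFill S` — **the filling** of a set
  `S ⊆ ℍ` accumulating on `ℝ` only at `0`: `ℍ` minus the connected component of `ℂ ∖ cl S`
  containing the lower half-plane — a form of [LSW]'s `F^ℝ_ℍ(S)`, "the union of `S` with the
  connected components of `ℍ̄ ∖ S` which do not intersect `ℝ`", written so that condition (2)
  of Def. 3.1, "`ℂ ∖ cl K` is connected", holds by construction (the comparison with the tree's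
  `twoSidedFilling` of `SLEBubbles` is not needed here and not made);
* `chordalFill_mem_restrictionConfigs` — **for `S ⊆ ℍ` connected, unbounded, with
  `cl S = S ∪ {0}`, the filling is a configuration of `Ω`** (relatively closed, connected — every
  filled-in component of `ℂ ∖ cl S` accumulates at a point of `S` —, `cl ∩ ℝ = {0}`, unbounded,
  connected complement of the closure);
* `disjoint_chordalFill_iff` — **the filling avoids `A ∈ 𝒬*` iff `S` does**: a `*`-hull has no
  floating pieces (`IsBoundedHull.isConnected_union_im_nonpos`, whence every point of `A` is
  connected inside `A` to a nonzero real point, `IsStarHull.exists_real_mem_connectedComponentIn`),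
  so `A ∖ ℝ` lies in the outer component of `ℂ ∖ cl S` as soon as `A ∩ S = ∅`;
* `Literature.Probability.RandomPlanarGeometry.IsChordalPath γ` — a **path from `0` to `∞` in
  `ℍ`**: `γ : [0, ∞) → ℂ` continuous, `γ 0 = 0`, `γ(t) ∈ ℍ` for `t > 0`, `|γ(t)| → ∞` (the
  almost sure shape of the Brownian excursion; the tree's `IsChordalSimplePath` minus
  injectivity), with its configuration `IsChordalPath.fillConfig = chordalFill γ(0, ∞) ∈ Ω` and
  `disjoint_fillConfig_iff : fillConfig ∩ A = ∅ ↔ γ[0, ∞) ∩ A = ∅` for `A ∈ 𝒬*`;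
* `exists_measurable_fillConfig_version`, `isRestrictionMeasure_map_fillConfig` — for a random
  path which is almost surely a chordal path, with a.e.-measurable marginals, the filling has an
  `Ω`-valued version measurable for the avoidance σ-field ([LSW] §3 p. 10), and **if
  `ℙ[γ[0, ∞) ∩ A = ∅] = Φ'_A(0)^α` for all `A ∈ 𝒬*` then its law is a two-sided restriction
  measure of exponent `α`** (`IsRestrictionMeasure α`) — the reading of "the law of the filling
  […] is `P_1`" (verbatim the argument of `SLEEightThirdsRestrictionLaw` for the SLE_{8/3} curve,
  with the filling in place of the simple curve);
* `exists_isRestrictionMeasure_of_chordalPath`, **`LawlerSchrammWerner2003_of_chordalPath`** —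
  hence `P_α` exists, and for `α = 1` [LSW] p. 5 result 2 follows, from ANY probability space
  carrying such a random path: with [LSW] Prop. 4.1 this is the Brownian excursion, so that
  `LawlerSchrammWerner2003_holds` is the last theorem applied to (a formalization of) Prop. 4.1.

Not in the tree (the remaining input, recorded for the discharge): the Brownian excursion and
Prop. 4.1. A route needing no Bessel-process or `h`-transform machinery: realize the excursion
as `B = X + i|W|` with `(X, W)` a FOUR-dimensional Brownian motion (`W` three-dimensional); for
`A ∈ 𝒬*` the function `u(x, w) = Im Φ_A(x + i|w|)/|w|` is harmonic on `ℝ⁴` off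
`{(x, w) : x + i|w| ∈ A}` (because `v = Im Φ_A / Im` satisfies `½Δv + ∂_y v / y = 0`), bounded by
`1` (`Im Φ_A(z) ≤ Im z`, [LSW] p. 16), tends to `1` at `∞` and to `0` at `A ∩ ℍ`, and
`u(0) = Φ'_A(0)`; optional stopping for `u(B)` and transience give Prop. 4.1.
-/

noncomputable section

open Set Filter Topology Metric Complex MeasureTheory
open UpperHalfPlane (upperHalfPlaneSet)
open scoped NNReal

namespace Literature.Probability.RandomPlanarGeometry

/-! ### The outer component and the filling -/

/-- The **outer component** of a set `S`: the connected component of `ℂ ∖ cl S` containing `−i`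
(for `S ⊆ ℍ̄`, the one containing the open lower half-plane). [folklore] -/
def outerComponent (S : Set ℂ) : Set ℂ := connectedComponentIn (closure S)ᶜ (-I)

/-- **The filling of `S`** ([LSW] §2 p. 8, `F^ℝ_ℍ`, for sets accumulating on `ℝ` only at `0`):
the open upper half-plane minus the outer component of `ℂ ∖ cl S`.
[cite: LawlerSchrammWerner2003Restriction, §2 p. 8 (Fillings) with Def. 3.1 (p. 10)] -/
def chordalFill (S : Set ℂ) : Set ℂ := upperHalfPlaneSet \ outerComponent S

variable {S : Set ℂ}

/-- The outer component is open. [folklore] -/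
theorem isOpen_outerComponent (S : Set ℂ) : IsOpen (outerComponent S) :=
  isClosed_closure.isOpen_compl.connectedComponentIn

/-- The outer component misses `cl S`. [folklore] -/
theorem outerComponent_subset (S : Set ℂ) : outerComponent S ⊆ (closure S)ᶜ :=
  connectedComponentIn_subset _ _

/-- The outer component is preconnected. [folklore] -/
theorem isPreconnected_outerComponent (S : Set ℂ) : IsPreconnected (outerComponent S) :=
  isPreconnected_connectedComponentIn

/-- For `S` in the closed upper half-plane, a point of the open lower half-plane is off `cl S`. [folklore] -/
theorem notMem_closure_of_im_neg (hS : S ⊆ {z : ℂ | 0 ≤ z.im}) {z : ℂ} (hz : z.im < 0) :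
    z ∉ closure S := fun h ↦ by
  have hcl : closure S ⊆ {z : ℂ | 0 ≤ z.im} :=
    closure_minimal hS (isClosed_le continuous_const continuous_im)
  exact absurd (hcl h) (not_le.2 hz)

/-- `−i` lies in the outer component (for `S ⊆ ℍ̄`). [folklore] -/
theorem neg_I_mem_outerComponent (hS : S ⊆ {z : ℂ | 0 ≤ z.im}) : -I ∈ outerComponent S :=
  mem_connectedComponentIn (notMem_closure_of_im_neg hS (by simp))

/-- The outer component is connected (for `S ⊆ ℍ̄`). [folklore] -/
theorem isConnected_outerComponent (hS : S ⊆ {z : ℂ | 0 ≤ z.im}) : IsConnected (outerComponent S) :=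
  ⟨⟨_, neg_I_mem_outerComponent hS⟩, isPreconnected_outerComponent S⟩

/-- The open lower half-plane lies in the outer component (for `S ⊆ ℍ̄`). [folklore] -/
theorem mem_outerComponent_of_im_neg (hS : S ⊆ {z : ℂ | 0 ≤ z.im}) {z : ℂ} (hz : z.im < 0) :
    z ∈ outerComponent S := by
  have hsub : {w : ℂ | w.im < 0} ⊆ (closure S)ᶜ := fun w hw ↦ notMem_closure_of_im_neg hS hw
  have hpre : IsPreconnected {w : ℂ | w.im < 0} := (convex_halfSpace_im_lt 0).isPreconnected
  have h := hpre.subset_connectedComponentIn (show -I ∈ {w : ℂ | w.im < 0} by simp) hsub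
  exact h hz

/-- A nonzero real point off `cl S` joins `−i` by a segment off `cl S`, so lies in the outer
component (for `S ⊆ ℍ̄` with `cl S ∩ ℝ ⊆ {0}`). [folklore] -/
theorem ofReal_mem_outerComponent (hS : S ⊆ {z : ℂ | 0 ≤ z.im})
    (hreal : ∀ x : ℝ, (x : ℂ) ∈ closure S → x = 0) {x : ℝ} (hx : x ≠ 0) :
    (x : ℂ) ∈ outerComponent S := by
  -- the segment from `x` to `−i`
  have hseg : segment ℝ (x : ℂ) (-I) ⊆ (closure S)ᶜ := by
    intro z hz hzS
    obtain ⟨a, b, ha, hb, hab, rfl⟩ := hz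
    rcases hb.eq_or_lt with rfl | hb'
    · simp only [zero_smul, add_zero] at hzS hab
      rw [hab, one_smul] at hzS
      exact hx (hreal x hzS)
    · refine notMem_closure_of_im_neg hS ?_ hzS
      simp only [add_im, smul_im, ofReal_im, smul_eq_mul, mul_zero, neg_im, I_im, zero_add]
      nlinarith
  have hpre : IsPreconnected (segment ℝ (x : ℂ) (-I)) := (convex_segment _ _).isPreconnected
  have h := hpre.subset_connectedComponentIn (right_mem_segment ℝ (x : ℂ) (-I)) hseg
  exact h (left_mem_segment ℝ (x : ℂ) (-I))

/-- `0 ∉` the outer component when `0 ∈ cl S`. [folklore] -/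
theorem zero_notMem_outerComponent (h0 : (0 : ℂ) ∈ closure S) : (0 : ℂ) ∉ outerComponent S :=
  fun h ↦ outerComponent_subset S h h0

/-- The filling lies in the open upper half-plane. [folklore] -/
theorem chordalFill_subset (S : Set ℂ) : chordalFill S ⊆ upperHalfPlaneSet := fun _ hz ↦ hz.1

/-- `S ⊆` its filling (for `S ⊆ ℍ`). [folklore] -/
theorem subset_chordalFill (hS : S ⊆ upperHalfPlaneSet) : S ⊆ chordalFill S := fun _ hz ↦
  ⟨hS hz, fun h ↦ outerComponent_subset S h (subset_closure hz)⟩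

/-- The filling misses the outer component. [folklore] -/
theorem disjoint_chordalFill_outerComponent (S : Set ℂ) : Disjoint (chordalFill S) (outerComponent S) :=
  disjoint_sdiff_left

section Config

variable (hS : S ⊆ upperHalfPlaneSet) (hreal : ∀ x : ℝ, (x : ℂ) ∈ closure S → x = 0)
include hS hreal

omit hreal in
/-- `S ⊆ ℍ̄`. [folklore] -/
private theorem subset_im_nonneg : S ⊆ {z : ℂ | 0 ≤ z.im} := fun _ hz ↦
  (show (0 : ℝ) < _ from hS hz).le

/-- **The complement of the outer component is the filling plus the origin** (for `S ⊆ ℍ` with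
`cl S ∩ ℝ ⊆ {0}` and `0 ∈ cl S`). [folklore] -/
theorem compl_outerComponent_eq (h0 : (0 : ℂ) ∈ closure S) :
    (outerComponent S)ᶜ = chordalFill S ∪ {0} := by
  refine Subset.antisymm ?_ (union_subset (fun z hz ↦ hz.2) ?_)
  · intro z hz
    rcases lt_trichotomy z.im 0 with him | him | him
    · exact absurd (mem_outerComponent_of_im_neg (subset_im_nonneg hS) him) hz
    · have hzre : z = (z.re : ℂ) := Complex.ext (by simp) (by simp [him])
      rcases eq_or_ne z.re 0 with hre | hre
      · right
        rw [hzre, hre]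
        simp
      · exact absurd (hzre ▸ ofReal_mem_outerComponent (subset_im_nonneg hS) hreal hre) hz
    · exact Or.inl ⟨him, hz⟩
  · rintro z (rfl : z = 0)
    exact zero_notMem_outerComponent h0

/-- **The closure of the filling is the complement of the outer component.** [folklore] -/
theorem closure_chordalFill (h0 : (0 : ℂ) ∈ closure S) :
    closure (chordalFill S) = (outerComponent S)ᶜ := by
  refine Subset.antisymm (closure_minimal (fun z hz ↦ hz.2) (isOpen_outerComponent S).isClosed_compl) ?_
  rw [compl_outerComponent_eq hS hreal h0]
  refine union_subset subset_closure ?_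
  rintro z (rfl : z = 0)
  exact closure_mono (subset_chordalFill hS) h0

/-- A component of `ℂ ∖ cl S` other than the outer one lies in the filling. [folklore] -/
theorem connectedComponentIn_subset_chordalFill {y : ℂ} (hy : y ∈ (closure S)ᶜ)
    (hyo : y ∉ outerComponent S) :
    connectedComponentIn (closure S)ᶜ y ⊆ chordalFill S := by
  intro z hz
  have hzo : z ∉ outerComponent S := fun hzo ↦ by
    -- the two components would coincide
    have h1 : connectedComponentIn (closure S)ᶜ y = connectedComponentIn (closure S)ᶜ z :=
      connectedComponentIn_eq hz
    have h2 : outerComponent S = connectedComponentIn (closure S)ᶜ z := connectedComponentIn_eq hzo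
    exact hyo (h2.symm ▸ h1 ▸ mem_connectedComponentIn hy)
  have hzS : z ∉ closure S := connectedComponentIn_subset _ _ hz
  rcases lt_trichotomy z.im 0 with him | him | him
  · exact absurd (mem_outerComponent_of_im_neg (subset_im_nonneg hS) him) hzo
  · have hzre : z = (z.re : ℂ) := Complex.ext (by simp) (by simp [him])
    rcases eq_or_ne z.re 0 with hre | hre
    · -- `z = 0 ∈ cl S`? only excluded if `0 ∈ cl S`; but then `z ∉ (cl S)ᶜ` — use `hreal` instead:
      -- `z` real and off `cl S`; if `z.re = 0` we still get `z ∈ outerComponent` unless `0 ∈ cl S`.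
      -- Either way `z ≠ 0` real gives a contradiction, and `z = 0` is handled via `hzS`/`h0`-free:
      exfalso
      -- the segment argument needs `z ≠ 0`; for `z = 0` off `cl S`, `0` joins `−i` vertically
      have hseg : segment ℝ (0 : ℂ) (-I) ⊆ (closure S)ᶜ := by
        intro w hw hwS
        obtain ⟨a, b, ha, hb, hab, rfl⟩ := hw
        rcases hb.eq_or_lt with rfl | hb'
        · simp only [zero_smul, add_zero, smul_zero] at hwS
          have : z = 0 := by rw [hzre, hre]; simp
          exact hzS (this ▸ hwS)
        · refine notMem_closure_of_im_neg (subset_im_nonneg hS) ?_ hwS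
          simp only [smul_zero, zero_add, smul_im, neg_im, I_im, smul_eq_mul]
          nlinarith
      have hpre : IsPreconnected (segment ℝ (0 : ℂ) (-I)) := (convex_segment _ _).isPreconnected
      have h := hpre.subset_connectedComponentIn (right_mem_segment ℝ (0 : ℂ) (-I)) hseg
      have h0o : (0 : ℂ) ∈ outerComponent S := h (left_mem_segment ℝ (0 : ℂ) (-I))
      have : z = 0 := by rw [hzre, hre]; simp
      exact hzo (this ▸ h0o)
    · exact absurd (hzre ▸ ofReal_mem_outerComponent (subset_im_nonneg hS) hreal hre) hzo
  · exact ⟨him, hzo⟩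

omit hS hreal in
/-- **A filled-in component accumulates at a nonzero point of `cl S`**: a component `C` of
`ℂ ∖ cl S` other than the outer one has a point `p ≠ 0` of `cl S` in its closure (otherwise
`cl C ⊆ C ∪ {0}`, and `ℂ ∖ {0}`, connected, would be the disjoint union of the open sets `C` and
`ℂ ∖ cl C`, forcing `−i ∈ C`). [folklore] -/
theorem exists_mem_closure_connectedComponentIn {y : ℂ} (hy : y ∈ (closure S)ᶜ)
    (hyo : y ∉ outerComponent S) :
    ∃ p ∈ closure (connectedComponentIn (closure S)ᶜ y), p ∈ closure S ∧ p ≠ 0 := by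
  set C : Set ℂ := connectedComponentIn (closure S)ᶜ y with hC
  have hCo : IsOpen C := isClosed_closure.isOpen_compl.connectedComponentIn
  have hyC : y ∈ C := mem_connectedComponentIn hy
  -- `cl C ∩ (cl S)ᶜ ⊆ C`
  have hclC : ∀ p ∈ closure C, p ∉ closure S → p ∈ C := by
    intro p hp hpS
    have hpo : connectedComponentIn (closure S)ᶜ p ∈ 𝓝 p :=
      (isClosed_closure.isOpen_compl.connectedComponentIn).mem_nhds (mem_connectedComponentIn hpS)
    obtain ⟨z, hzp, hzC⟩ := mem_closure_iff_nhds.1 hp _ hpo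
    have h1 : connectedComponentIn (closure S)ᶜ p = connectedComponentIn (closure S)ᶜ z :=
      connectedComponentIn_eq hzp
    have h2 : C = connectedComponentIn (closure S)ᶜ z := connectedComponentIn_eq hzC
    rw [h2, ← h1]
    exact mem_connectedComponentIn hpS
  have hIC : -I ∉ C := fun h ↦ hyo (by
    have h1 : C = connectedComponentIn (closure S)ᶜ (-I) := connectedComponentIn_eq h
    show y ∈ connectedComponentIn (closure S)ᶜ (-I)
    rw [← h1]; exact hyC)
  by_contra hno
  push Not at hno
  -- then `cl C ⊆ C ∪ {0}`
  have hcl : closure C ⊆ C ∪ {0} := by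
    intro p hp
    by_cases hpS : p ∈ closure S
    · exact Or.inr (hno p hp hpS)
    · exact Or.inl (hclC p hp hpS)
  -- `ℂ ∖ {0}` is connected and covered by the disjoint open sets `C` and `(cl C)ᶜ`
  have hconn : IsConnected ({(0 : ℂ)}ᶜ) :=
    isConnected_compl_singleton_of_one_lt_rank (by simp [Complex.rank_real_complex]) 0
  have hpre := hconn.isPreconnected
  rw [isPreconnected_iff_subset_of_disjoint] at hpre
  have hcover : ({(0 : ℂ)}ᶜ : Set ℂ) ⊆ C ∪ (closure C)ᶜ := by
    intro p hp
    by_cases hpc : p ∈ closure C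
    · rcases hcl hpc with h | h
      · exact Or.inl h
      · exact absurd h hp
    · exact Or.inr hpc
  have hdisj : ({(0 : ℂ)}ᶜ : Set ℂ) ∩ (C ∩ (closure C)ᶜ) = ∅ := by
    rw [eq_empty_iff_forall_notMem]
    rintro p ⟨-, hpC, hpc⟩
    exact hpc (subset_closure hpC)
  rcases hpre C (closure C)ᶜ hCo isClosed_closure.isOpen_compl hcover hdisj with h | h
  · -- `−i ∈ C`
    exact hIC (h (show (-I : ℂ) ∈ ({(0 : ℂ)}ᶜ : Set ℂ) by simp))
  · -- the open nonempty `C` has a point `y' ≠ 0`, which would lie off `cl C`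
    obtain ⟨y', hy'C, hy'0⟩ := (dense_compl_singleton (0 : ℂ)).inter_open_nonempty C hCo ⟨y, hyC⟩
    exact (h hy'0) (subset_closure hy'C)

end Config

section Omega

variable (hS : S ⊆ upperHalfPlaneSet) (hconn : IsConnected S) (hcl : closure S = S ∪ {0})
  (hunb : ¬ Bornology.IsBounded S)
include hS hcl

/-- Real points of `cl S = S ∪ {0}` vanish, for `S ⊆ ℍ`. [folklore] -/
private theorem hreal_of_closure : ∀ x : ℝ, (x : ℂ) ∈ closure S → x = 0 := by
  intro x hx
  rw [hcl] at hx
  rcases hx with hx | hx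
  · have : (0 : ℝ) < (x : ℂ).im := hS hx
    simp at this
  · exact_mod_cast (mem_singleton_iff.1 hx)

omit hS in
/-- `0 ∈ cl S`. [folklore] -/
private theorem zero_mem_closure' : (0 : ℂ) ∈ closure S := by
  rw [hcl]; exact Or.inr rfl

include hconn in
/-- **The filling of a connected `S ⊆ ℍ` with `cl S = S ∪ {0}` is connected**: it is `S`
together with the filled-in components, each of which accumulates at a point of `S`. [folklore] -/
theorem isConnected_chordalFill : IsConnected (chordalFill S) := by
  have hreal := hreal_of_closure hS hcl
  obtain ⟨s₀, hs₀⟩ := hconn.nonempty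
  refine ⟨⟨s₀, subset_chordalFill hS hs₀⟩, isPreconnected_of_forall s₀ fun y hy ↦ ?_⟩
  by_cases hyS : y ∈ S
  · exact ⟨S, subset_chordalFill hS, hs₀, hyS, hconn.isPreconnected⟩
  · have hy0 : y ≠ 0 := fun h ↦ by
      have : (0 : ℝ) < y.im := hy.1
      rw [h] at this; simp at this
    have hycl : y ∈ (closure S)ᶜ := by
      rw [hcl]; rintro (h | h); exacts [hyS h, hy0 h]
    set C : Set ℂ := connectedComponentIn (closure S)ᶜ y with hC
    obtain ⟨p, hpC, hpS, hp0⟩ := exists_mem_closure_connectedComponentIn hycl hy.2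
    have hpS' : p ∈ S := by
      rw [hcl] at hpS
      exact hpS.resolve_right hp0
    have hCsub : C ⊆ chordalFill S := connectedComponentIn_subset_chordalFill hS hreal hycl hy.2
    refine ⟨S ∪ insert p C, union_subset (subset_chordalFill hS) ?_, Or.inl hs₀,
      Or.inr (mem_insert_of_mem _ (mem_connectedComponentIn hycl)), ?_⟩
    · exact insert_subset (subset_chordalFill hS hpS') hCsub
    · refine IsPreconnected.union p hpS' (mem_insert _ _) hconn.isPreconnected ?_
      exact isPreconnected_connectedComponentIn.subset_closure (subset_insert _ _)
        (insert_subset hpC subset_closure)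

include hconn hunb in
/-- **The filling of a connected unbounded `S ⊆ ℍ` with `cl S = S ∪ {0}` is a configuration
of `Ω`** ([LSW] Def. 3.1): relatively closed in `ℍ`, connected, its closure meets `ℝ` exactly
at `0`, unbounded, and the complement of its closure — the outer component — is connected.
[cite: LawlerSchrammWerner2003Restriction, Def. 3.1 (p. 10) with §2 p. 8 (Fillings)] -/
theorem chordalFill_mem_restrictionConfigs : chordalFill S ∈ restrictionConfigs := by
  have hreal := hreal_of_closure hS hcl
  have h0 := zero_mem_closure' hcl
  have hclF := closure_chordalFill hS hreal h0
  refine ⟨?_, isConnected_chordalFill hS hconn hcl, ?_, ?_, ?_⟩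
  · rw [hclF]
    ext z
    exact ⟨fun ⟨h1, h2⟩ ↦ ⟨h2, h1⟩, fun ⟨h1, h2⟩ ↦ ⟨h2, h1⟩⟩
  · rw [hclF, compl_outerComponent_eq hS hreal h0]
    refine Subset.antisymm ?_ ?_
    · rintro z ⟨hz | hz, ⟨x, rfl⟩⟩
      · have : (0 : ℝ) < (x : ℂ).im := hz.1
        simp at this
      · exact hz
    · rintro z (rfl : z = 0)
      exact ⟨Or.inr rfl, ⟨0, Complex.ofReal_zero⟩⟩
  · exact fun hb ↦ hunb (hb.subset (subset_chordalFill hS))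
  · rw [hclF, compl_compl]
    exact isConnected_outerComponent (subset_im_nonneg hS)

/-- **The filling avoids a `*`-hull iff `S` does.** For `A ∈ 𝒬*` with `A ∩ S = ∅`: `A` misses
`cl S = S ∪ {0}` (`0 ∉ A`); every point of `A` is connected inside `A` to a nonzero real point
(`IsStarHull.exists_real_mem_connectedComponentIn`, a `*`-hull having no floating pieces,
`IsBoundedHull.isConnected_union_im_nonpos`), which lies in the outer component; so `A` lies in
the outer component, off the filling. [folklore] -/
theorem disjoint_chordalFill_iff {A : Set ℂ} (hA : IsStarHull A) :
    Disjoint (chordalFill S) A ↔ Disjoint S A := by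
  have hreal := hreal_of_closure hS hcl
  refine ⟨fun h ↦ h.mono_left (subset_chordalFill hS), fun h ↦ ?_⟩
  have hAcl : A ⊆ (closure S)ᶜ := by
    intro a ha hacl
    rw [hcl] at hacl
    rcases hacl with h' | h'
    · exact Set.disjoint_left.1 h h' ha
    · exact hA.zero_notMem ((mem_singleton_iff.1 h') ▸ ha)
  rw [Set.disjoint_left]
  intro a haF haA
  obtain ⟨x, hx0, hxC⟩ := hA.exists_real_mem_connectedComponentIn
    hA.isBoundedHull.isConnected_union_im_nonpos haA
  have hxo : (x : ℂ) ∈ outerComponent S := ofReal_mem_outerComponent (subset_im_nonneg hS) hreal hx0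
  -- the component of `a` in `A` is a preconnected subset of `(cl S)ᶜ` through `x`
  have hsub : connectedComponentIn A a ⊆ outerComponent S := by
    have h1 := (isPreconnected_connectedComponentIn (F := A) (x := a)).subset_connectedComponentIn
      hxC ((connectedComponentIn_subset _ _).trans hAcl)
    rwa [← connectedComponentIn_eq hxo] at h1
  exact haF.2 (hsub (mem_connectedComponentIn haA))

end Omega

/-! ### Paths from `0` to `∞` in the upper half-plane -/

/-- **A path from `0` to `∞` in the upper half-plane**: `γ : [0, ∞) → ℂ` continuous,
`γ 0 = 0`, `γ(t) ∈ ℍ` for `t > 0`, and transient, `|γ(t)| → ∞` — the almost sure shape of the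
Brownian excursion from `0` to `∞` in `ℍ` ([LSW] §4: "`B(0, ∞) ⊂ ℍ` almost surely", "almost
surely `lim_{t→∞} Y_t = ∞`"). [cite: LawlerSchrammWerner2003Restriction, §4 (p. 16)] -/
def IsChordalPath (γ : ℝ≥0 → ℂ) : Prop :=
  Continuous γ ∧ (∀ t : ℝ≥0, 0 < t → 0 < (γ t).im) ∧ γ 0 = 0 ∧ Tendsto (fun t ↦ ‖γ t‖) atTop atTop

/-- A chordal simple path is a chordal path. [folklore] -/
theorem IsChordalSimplePath.isChordalPath {γ : ℝ≥0 → ℂ} (h : IsChordalSimplePath γ) :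
    IsChordalPath γ :=
  ⟨h.continuous, fun _ ht ↦ h.im_pos ht, h.apply_zero, h.tendsto_norm⟩

namespace IsChordalPath

variable {γ : ℝ≥0 → ℂ}

/-- A chordal path is continuous. [folklore] -/
theorem continuous (h : IsChordalPath γ) : Continuous γ := h.1

/-- A chordal path is in `ℍ` at positive times. [folklore] -/
theorem im_pos (h : IsChordalPath γ) {t : ℝ≥0} (ht : 0 < t) : 0 < (γ t).im := h.2.1 t ht

/-- A chordal path starts at `0`. [folklore] -/
theorem apply_zero (h : IsChordalPath γ) : γ 0 = 0 := h.2.2.1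

/-- A chordal path is transient. [folklore] -/
theorem tendsto_norm (h : IsChordalPath γ) : Tendsto (fun t ↦ ‖γ t‖) atTop atTop := h.2.2.2

/-- The range of a chordal path is closed (the path is a proper map). [folklore] -/
theorem isClosed_range (h : IsChordalPath γ) : IsClosed (range γ) := by
  refine (isProperMap_iff_tendsto_cocompact.2 ⟨h.continuous, ?_⟩).isClosedMap.isClosed_range
  rw [cocompact_eq_atTop, ← cobounded_eq_cocompact, ← comap_norm_atTop, tendsto_comap_iff]
  exact h.tendsto_norm

/-- `range γ = γ(0, ∞) ∪ {0}`. [folklore] -/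
theorem range_eq (h : IsChordalPath γ) : range γ = γ '' Ioi 0 ∪ {0} := by
  refine Subset.antisymm ?_ (union_subset (image_subset_range _ _) ?_)
  · rintro _ ⟨t, rfl⟩
    rcases eq_or_ne t 0 with rfl | ht
    · exact Or.inr (by rw [h.apply_zero]; rfl)
    · exact Or.inl ⟨t, pos_iff_ne_zero.2 ht, rfl⟩
  · rintro _ rfl
    exact ⟨0, h.apply_zero⟩

/-- `cl γ(0, ∞) = γ[0, ∞)`. [folklore] -/
theorem closure_image_Ioi (h : IsChordalPath γ) : closure (γ '' Ioi 0) = range γ := by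
  refine Subset.antisymm (closure_minimal (image_subset_range _ _) h.isClosed_range) ?_
  have h1 : γ '' closure (Ioi 0) ⊆ closure (γ '' Ioi 0) :=
    image_closure_subset_closure_image h.continuous
  have h2 : closure (Ioi (0 : ℝ≥0)) = univ := by
    rw [closure_Ioi' ⟨1, by simp⟩]
    ext t
    simp
  rw [h2, image_univ] at h1
  exact h1

/-- `γ(0, ∞) ⊆ ℍ`. [folklore] -/
theorem image_Ioi_subset (h : IsChordalPath γ) : γ '' Ioi 0 ⊆ upperHalfPlaneSet := by
  rintro _ ⟨t, ht, rfl⟩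
  exact h.im_pos ht

/-- `γ(0, ∞)` is connected. [folklore] -/
theorem isConnected_image_Ioi (h : IsChordalPath γ) : IsConnected (γ '' Ioi 0) :=
  isConnected_Ioi.image γ h.continuous.continuousOn

/-- `γ(0, ∞)` is unbounded. [folklore] -/
theorem not_isBounded_image_Ioi (h : IsChordalPath γ) : ¬ Bornology.IsBounded (γ '' Ioi 0) := by
  intro hb
  obtain ⟨R, hR⟩ := hb.subset_closedBall 0
  have hev := (h.tendsto_norm.eventually_gt_atTop R).and (Filter.eventually_gt_atTop 0)
  obtain ⟨t, ht, ht0⟩ := hev.exists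
  have := hR ⟨t, ht0, rfl⟩
  rw [mem_closedBall, dist_zero_right] at this
  linarith

/-- **The filling of a path from `0` to `∞` in `ℍ` is a configuration of `Ω`** ([LSW] §4 with
Def. 3.1: the filled Brownian excursion as a random element of `Ω`).
[cite: LawlerSchrammWerner2003Restriction, Def. 3.1 (p. 10) with §4 (p. 16)] -/
theorem chordalFill_mem_restrictionConfigs (h : IsChordalPath γ) :
    chordalFill (γ '' Ioi 0) ∈ restrictionConfigs :=
  Literature.Probability.RandomPlanarGeometry.chordalFill_mem_restrictionConfigs h.image_Ioi_subset
    h.isConnected_image_Ioi (by rw [h.closure_image_Ioi, h.range_eq]) h.not_isBounded_image_Ioi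

/-- **The configuration `F(γ(0, ∞)) ∈ Ω` of a path from `0` to `∞` in `ℍ`.**
[cite: LawlerSchrammWerner2003Restriction, Def. 3.1 (p. 10) with §4 (p. 16)] -/
def fillConfig (h : IsChordalPath γ) : RestrictionConfig :=
  ⟨chordalFill (γ '' Ioi 0), h.chordalFill_mem_restrictionConfigs⟩

/-- The underlying set of the filled configuration. [folklore] -/
@[simp] theorem coe_fillConfig (h : IsChordalPath γ) :
    ((h.fillConfig : RestrictionConfig) : Set ℂ) = chordalFill (γ '' Ioi 0) := rfl

/-- The path lies in its filled configuration. [folklore] -/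
theorem image_Ioi_subset_fillConfig (h : IsChordalPath γ) :
    γ '' Ioi 0 ⊆ ((h.fillConfig : RestrictionConfig) : Set ℂ) :=
  subset_chordalFill h.image_Ioi_subset

/-- **The filled configuration avoids `A ∈ 𝒬*` iff the path does** (`γ[0, ∞) = γ(0, ∞) ∪ {0}`
and `0 ∉ A`). [folklore] -/
theorem disjoint_fillConfig_iff (h : IsChordalPath γ) {A : Set ℂ} (hA : IsStarHull A) :
    Disjoint ((h.fillConfig : RestrictionConfig) : Set ℂ) A ↔ Disjoint (range γ) A := by
  rw [coe_fillConfig, Literature.Probability.RandomPlanarGeometry.disjoint_chordalFill_iff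
    h.image_Ioi_subset (by rw [h.closure_image_Ioi, h.range_eq]) hA, h.range_eq,
    Set.disjoint_union_left, Set.disjoint_singleton_left]
  exact ⟨fun h' ↦ ⟨h', hA.zero_notMem⟩, fun h' ↦ h'.1⟩

end IsChordalPath

/-! ### Random chordal paths: a measurable `Ω`-valued version of the filling, and its law -/

section Law

variable {Ω' : Type*} [MeasurableSpace Ω'] {ℙ : Measure Ω'} {B : Ω' → ℝ≥0 → ℂ}

/-- **The filling of a random path from `0` to `∞` in `ℍ` as a random element of `Ω`** ([LSW]
§3 p. 10, the avoidance σ-field): if almost every sample path is a chordal path and the marginals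
at rational times are a.e.-measurable, there is a map `Kc : Ω' → Ω`, measurable for the σ-field
generated by the events `{K ∩ A = ∅}`, `A ∈ 𝒬*`, which almost surely is the filling of
`B(0, ∞)`. (On a measurable full-measure set the path is chordal with rational-time values given
by measurable modifications; there `{Kc ∩ A = ∅}` is the countable Boolean combination of
`disjoint_image_Ioi_iff_rat`, by `IsChordalPath.disjoint_fillConfig_iff`.)
[cite: LawlerSchrammWerner2003Restriction, §3 p. 10 with §4 (p. 16)] -/
theorem exists_measurable_fillConfig_version (hpath : ∀ᵐ ω ∂ℙ, IsChordalPath (B ω))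
    (hmk : ∀ q : ℚ, AEMeasurable (fun ω ↦ B ω (Real.toNNReal q)) ℙ) :
    ∃ Kc : Ω' → RestrictionConfig, Measurable Kc ∧
      ∀ᵐ ω ∂ℙ, ∃ h : IsChordalPath (B ω), Kc ω = h.fillConfig := by
  classical
  set G : ℚ → Ω' → ℂ := fun q ↦ (hmk q).mk _ with hG
  have hGm : ∀ q, Measurable (G q) := fun q ↦ (hmk q).measurable_mk
  have hGae : ∀ᵐ ω ∂ℙ, ∀ q : ℚ, B ω (Real.toNNReal q) = G q ω :=
    ae_all_iff.2 fun q ↦ (hmk q).ae_eq_mk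
  have hgood : ∀ᵐ ω ∂ℙ, IsChordalPath (B ω) ∧ ∀ q : ℚ, B ω (Real.toNNReal q) = G q ω :=
    hpath.and hGae
  obtain ⟨S, hSm, hSae, hS⟩ : ∃ S : Set Ω', MeasurableSet S ∧ (∀ᵐ ω ∂ℙ, ω ∈ S) ∧
      ∀ ω ∈ S, IsChordalPath (B ω) ∧ ∀ q : ℚ, B ω (Real.toNNReal q) = G q ω := by
    rw [ae_iff] at hgood
    obtain ⟨T, hNT, hTm, hT0⟩ := exists_measurable_superset_of_null hgood
    refine ⟨Tᶜ, hTm.compl, compl_mem_ae_iff.2 hT0, fun ω hω ↦ ?_⟩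
    by_contra h
    exact hω (hNT h)
  refine ⟨fun ω ↦ if h : ω ∈ S then (hS ω h).1.fillConfig else RestrictionConfig.imaginaryAxis,
    ?_, ?_⟩
  · refine RestrictionConfig.measurable_of_measurableSet_disjoint fun A hA ↦ ?_
    rcases A.eq_empty_or_nonempty with rfl | hne
    · simp
    have hAc : IsClosed A := hA.isBoundedHull.isClosed
    have himp : ∀ (P : Prop) {s : Set Ω'}, MeasurableSet s → MeasurableSet {ω | P → ω ∈ s} := by
      intro P s hs
      by_cases hP : P
      · simpa [hP] using hs
      · simp [hP]
    set E : Set Ω' := {ω | ∀ n : ℕ, ∃ m : ℕ, ∀ q : ℚ, (1 / (n + 1) : ℝ) ≤ q →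
        (q : ℝ) ≤ n + 1 → (1 / (m + 1) : ℝ) ≤ infDist (G q ω) A} with hE
    have hEeq : E = ⋂ n : ℕ, ⋃ m : ℕ, ⋂ q : ℚ, {ω | (1 / (n + 1) : ℝ) ≤ q → (q : ℝ) ≤ n + 1 →
        (1 / (m + 1) : ℝ) ≤ infDist (G q ω) A} := by
      ext ω
      simp only [hE, mem_setOf_eq, mem_iInter, mem_iUnion]
    have hEm : MeasurableSet E := by
      rw [hEeq]
      exact MeasurableSet.iInter fun n ↦ MeasurableSet.iUnion fun m ↦
        MeasurableSet.iInter fun q ↦ himp _ (himp _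
          (measurableSet_le measurable_const ((continuous_infDist_pt A).measurable.comp (hGm q))))
    -- on `S`: `{Kc ∩ A = ∅} = {range B ∩ A = ∅} = {B(0,∞) ∩ A = ∅} = E`
    have heq : {ω | Disjoint (((if h : ω ∈ S then (hS ω h).1.fillConfig
        else RestrictionConfig.imaginaryAxis : RestrictionConfig) : Set ℂ)) A} =
          (S ∩ E) ∪ (Sᶜ ∩ {_ω | Disjoint ((RestrictionConfig.imaginaryAxis : RestrictionConfig) :
            Set ℂ) A}) := by
      ext ω
      simp only [mem_setOf_eq, mem_union, mem_inter_iff, mem_compl_iff]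
      by_cases hω : ω ∈ S
      · rw [dif_pos hω, (hS ω hω).1.disjoint_fillConfig_iff hA, (hS ω hω).1.range_eq,
          Set.disjoint_union_left, Set.disjoint_singleton_left,
          disjoint_image_Ioi_iff_rat (hS ω hω).1.continuous hAc hne]
        simp only [hω, true_and, not_true_eq_false, false_and, or_false, hE, mem_setOf_eq,
          (hS ω hω).2, hA.zero_notMem, not_false_eq_true, and_true]
      · rw [dif_neg hω]
        simp [hω]
    rw [heq]
    exact (hSm.inter hEm).union (hSm.compl.inter (MeasurableSet.const _))
  · filter_upwards [hSae] with ω hω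
    exact ⟨(hS ω hω).1, by simp only [dif_pos hω]⟩

/-- **"The law of the filling is `P_α`"** ([LSW] §4 p. 16 for the Brownian excursion, `α = 1`;
Def. 3.4 / Prop. 3.3 (3)): if moreover `ℙ[B[0, ∞) ∩ A = ∅] = Φ'_A(0)^α` for every `A ∈ 𝒬*`
(every restriction map `Φ_A` and its derivative at `0`), the law of the `Ω`-valued version of
the filling is a two-sided restriction measure of exponent `α`.
[cite: LawlerSchrammWerner2003Restriction, §4 p. 16 (the law of the filling is P_1) with Def. 3.1, Prop. 3.3] -/
theorem isRestrictionMeasure_map_fillConfig [IsProbabilityMeasure ℙ]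
    (hpath : ∀ᵐ ω ∂ℙ, IsChordalPath (B ω))
    (hmk : ∀ q : ℚ, AEMeasurable (fun ω ↦ B ω (Real.toNNReal q)) ℙ) {α : ℝ}
    (havoid : ∀ {A : Set ℂ}, IsStarHull A →
      ∀ {Φ : ConformalEquiv (upperHalfPlaneSet \ A) upperHalfPlaneSet}, IsRestrictionMap A Φ →
        ∀ {d : ℝ}, HasRestrictionDeriv A Φ d →
          ℙ {ω | Disjoint (range (B ω)) A} = ENNReal.ofReal (d ^ α)) :
    ∃ Kc : Ω' → RestrictionConfig, Measurable Kc ∧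
      (∀ᵐ ω ∂ℙ, ∃ h : IsChordalPath (B ω), Kc ω = h.fillConfig) ∧
        IsRestrictionMeasure α (ℙ.map Kc) := by
  obtain ⟨Kc, hKc, hae⟩ := exists_measurable_fillConfig_version hpath hmk
  refine ⟨Kc, hKc, hae, IsRestrictionMeasure.map_of_measure_disjoint hKc fun {A} hA Φ hΦ d hd ↦ ?_⟩
  have heq : {ω | Disjoint ((Kc ω : Set ℂ)) A} =ᵐ[ℙ] {ω | Disjoint (range (B ω)) A} := by
    filter_upwards [hae] with ω ⟨h, hω⟩
    show (Disjoint ((Kc ω : Set ℂ)) A) = Disjoint (range (B ω)) A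
    rw [hω, h.disjoint_fillConfig_iff hA]
  rw [measure_congr heq]
  exact havoid hA hΦ hd

/-- **`P_α` exists as soon as some probability space carries a random path from `0` to `∞` in
`ℍ` avoiding each `A ∈ 𝒬*` with probability `Φ'_A(0)^α`** — for `α = 1`, [LSW] §4: "We have
just proved that the two-sided restriction measure `P_1` exists" (given Prop. 4.1 for the
Brownian excursion). [cite: LawlerSchrammWerner2003Restriction, §4 Prop. 4.1 (p. 16) and the sentence following its proof] -/
theorem exists_isRestrictionMeasure_of_chordalPath [IsProbabilityMeasure ℙ]
    (hpath : ∀ᵐ ω ∂ℙ, IsChordalPath (B ω))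
    (hmk : ∀ q : ℚ, AEMeasurable (fun ω ↦ B ω (Real.toNNReal q)) ℙ) {α : ℝ}
    (havoid : ∀ {A : Set ℂ}, IsStarHull A →
      ∀ {Φ : ConformalEquiv (upperHalfPlaneSet \ A) upperHalfPlaneSet}, IsRestrictionMap A Φ →
        ∀ {d : ℝ}, HasRestrictionDeriv A Φ d →
          ℙ {ω | Disjoint (range (B ω)) A} = ENNReal.ofReal (d ^ α)) :
    ∃ P : Measure RestrictionConfig, IsRestrictionMeasure α P := by
  obtain ⟨Kc, -, -, hP⟩ := isRestrictionMeasure_map_fillConfig hpath hmk havoid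
  exact ⟨_, hP⟩

end Law

/-! ### [LSW] p. 5 result 2 from Prop. 4.1 -/

/-- **`LawlerSchrammWerner2003` (chordal restriction + simple curves ⇒ SLE_{8/3}) from [LSW]
Prop. 4.1 in the form: some probability space carries a random path which is almost surely a
path from `0` to `∞` in `ℍ` (continuous, `B_0 = 0`, `B_t ∈ ℍ` for `t > 0`, `|B_t| → ∞`), with
a.e.-measurable marginals, and `ℙ[B[0, ∞) ∩ A = ∅] = Φ'_A(0)` for all `A ∈ 𝒬*`** — in [LSW] the
Brownian excursion (Prop. 4.1, Virág). Its filling has law `P_1`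
(`exists_isRestrictionMeasure_of_chordalPath`), and `P_1` alone gives p. 5 result 2
(`LawlerSchrammWerner2003_of_exists_one`).
[cite: LawlerSchrammWerner2003Restriction, Prop. 4.1 (p. 16) with p. 5 result 2] -/
theorem LawlerSchrammWerner2003_of_chordalPath {Ω' : Type*} [MeasurableSpace Ω']
    {ℙ : Measure Ω'} [IsProbabilityMeasure ℙ] {B : Ω' → ℝ≥0 → ℂ}
    (hpath : ∀ᵐ ω ∂ℙ, IsChordalPath (B ω))
    (hmk : ∀ q : ℚ, AEMeasurable (fun ω ↦ B ω (Real.toNNReal q)) ℙ)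
    (h41 : ∀ {A : Set ℂ}, IsStarHull A →
      ∀ {Φ : ConformalEquiv (upperHalfPlaneSet \ A) upperHalfPlaneSet}, IsRestrictionMap A Φ →
        ∀ {d : ℝ}, HasRestrictionDeriv A Φ d →
          ℙ {ω | Disjoint (range (B ω)) A} = ENNReal.ofReal d) :
    LawlerSchrammWerner2003 :=
  LawlerSchrammWerner2003_of_exists_one
    (exists_isRestrictionMeasure_of_chordalPath hpath hmk (α := 1) fun hA _ hΦ _ hd ↦ by
      rw [Real.rpow_one]; exact h41 hA hΦ hd)

end Literature.Probability.RandomPlanarGeometry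

end
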